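import Mathlib.Algebra.CharP.Defs
import Mathlib.LinearAlgebra.Matrix.Rank
import Literature.Computability.AlgebraicComplexity.CCL10HessianCharP
import Literature.Computability.AlgebraicComplexity.BS26PermanentHessianFullRank
import HarnessLib

/-!
# Full rank of the off-diagonal Hessian block of `per` at `Mⁿ_{−n}`:
# `m² − m ≤ 2·dc(per_m)` over every field with `2 ≠ 0` (row BS26-A, part D)

Cell val-lit (D-0074), row BS26-A (lead-lmr RULINGS 2026-08-26T07:22:44Z / 08:17:30Z / 08:39:50Z;
blueprint `HOME/lmr/BLUEPRINT-OddCharHessianBound.md` by val-lit-lit g2). PART D = the assembly: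

* part B (t17, `CCL10HessianCharP.lean` v7): the closed form
  `hessianMatrix_perPoly_caiChenLiMatrix_offDiag` of ALL off-diagonal-pair Hessian entries of
  `per_{n+1}` at the Cai–Chen–Li point `Mⁿ_v = caiChenLiMatrix F n v` (identity bordered by a last
  row and column of ones, corner `v`; special index `★ = Fin.last n`);
* part C (t15, `BS26PermanentHessianFullRank.lean`): the integer matrices `R = BS26.bsR`,
  `S = BS26.bsS` on `P = {(i,j) : i ≠ j}` with `R·S = 4·1` over every commutative ring, hence
  `rank R = |P| = (n+1)·n` over a field with `2 ≠ 0` (`BS26.rank_bsR`);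
* part D (this file): at the corner value `v = −n` (taken IN THE FIELD, so `per(Mⁿ_{−n}) = n − n = 0`
  over every field, `eval_caiChenLiMatrix_neg_perPoly`) the principal submatrix of the Hessian on `P`
  IS `R` (`submatrix_hessianMatrix_perPoly_caiChenLiMatrix_neg`, entrywise
  `hessianMatrix_perPoly_caiChenLiMatrix_neg_apply`: rows `(★,a)` = `[k = a]`, rows `(a,★)` = `[l = a]`,
  inner rows `(a,b)` = `[k = b] + [l = a] − 4·[(k,l) = (b,a)]`, the inner transposed value
  `v + (n−2) = −2`); therefore `rank H(Mⁿ_{−n}) ≥ (n+1)·n` (`rank_hessianMatrix_perPoly_caiChenLiMatrix_neg_ge`,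
  via Mathlib's `Matrix.rank_submatrix_le`), and the tree's Mignon–Ressayre chain rule
  `rank H(X₀) ≤ 2·dc(f)` at a zero `X₀` of `f` (`rank_hessianMatrix_le_two_mul_determinantalComplexity`,
  `HessianRank.lean`) gives the target

  `sq_sub_le_two_mul_determinantalComplexity_perPoly_of_two_ne_zero :
     (2 : F) ≠ 0 → ∀ m, m ^ 2 - m ≤ 2 * determinantalComplexity (perPoly (Fin m) F)`,

  with the by-name variants `…_charP` (odd prime characteristic), `…_of_ringChar_ne_two`
  (every field of characteristic `≠ 2`) and the binomial form `choose_two_le_…` (`C(m,2) ≤ dc(per_m)`).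

What this supersedes numerically (not textually — the printed statements stay as typed): the
consequences of Cai–Chen–Li 2010 Thm. 2.3 in odd characteristic (`caiChenLi2010_quadratic_lower_bound`:
`(n−p−2)(n−p−3) ≤ 2·dc(per_n)` for `n ≥ p+3`) and t17's inverse-free interim bound
`m² ≤ 2·dc(per_m) + 5m` (v8). In characteristic `0` the tree already has the stronger Mignon–Ressayre
bound `m² ≤ 2·dc(per_m)` (`sq_le_two_mul_determinantalComplexity_perPoly_charZero_holds`); in
characteristic `2` no such bound can hold (`per = det`, `Literature.Barriers.ValiantsHypothesis.CharacteristicTwo`).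

Attribution. The integer witness (= `Mⁿ_{−n}` up to moving the special index to the front) and the
statement «the off-diagonal Hessian block of `per_m` at it is of full rank `m² − m` whenever `2 ≠ 0`»
are K. Bedi – J. Suagee's [BediSuagee2026] (Theory Comput. Syst. 70 (2026) art. 13; printed text NOT
held by the cell, acq-01251 cite-only; statement inferred from the authors' public companion
repository and RE-DERIVED / machine-checked numerically by val-lit-lit g2, then PROVED here and in
parts B/C — so NO named fact is typed from that source, only proved theorems). Hessian method:
Mignon–Ressayre 2004 §2–3; witness family and Lemma 2.5: Cai–Chen–Li 2010 §2. Theorems only; no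
definitions, no named facts. Honest framing: an elementary full-rank certificate giving a QUADRATIC
lower bound; the superquadratic rungs and `VP ≠ VNP` are untouched — VP ≠ VNP is NOT proved and
nothing here is progress on it.

## References

* [BediSuagee2026] K. Bedi, J. Suagee, Theory Comput. Syst. 70 (2026) art. 13,
  doi:10.1007/s00224-025-10253-8 (not held; acq-01251); companion repository
  `hessian_of_permanent_is_full_rank_demonstration`.
* [CaiChenLi2010] J.-Y. Cai, X. Chen, D. Li, *Quadratic lower bound for permanent vs. determinant in
  any characteristic*, comput. complex. 19 (2010) 37–56, §2.1–2.2 (pp. 41–44), Lemma 2.5 (p. 44).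
* [MignonRessayre2004] T. Mignon, N. Ressayre, *A quadratic bound for the determinant and permanent
  problem*, IMRN 2004:79, 4241–4253, §2–3.
-/
noncomputable section

open MvPolynomial Matrix

namespace Literature.Computability.AlgebraicComplexity

universe u


section FullRank

variable {F : Type u} [Field F]

/-- Two distinct non-last indices of `Fin (n+1)` exist only when `2 ≤ n` (so that the inner value
`v + (n − 2)` of the closed form has no truncated subtraction when it is used). [folklore] -/
private theorem two_le_of_ne_of_ne_last_bs26D {n : ℕ} {i j : Fin (n + 1)} (hij : i ≠ j)
    (hi : i ≠ Fin.last n) (hj : j ≠ Fin.last n) : 2 ≤ n := by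
  have hi' := Fin.val_lt_last hi
  have hj' := Fin.val_lt_last hj
  have hij' : (i : ℕ) ≠ j := fun h => hij (Fin.ext h)
  omega

/-- **Bridge (part D of row BS26-A): the Hessian of `per_{n+1}` at the Cai–Chen–Li point with
corner `v = −n`, `Mⁿ_{−n} = caiChenLiMatrix F n (−n)`, has on off-diagonal pairs exactly the entries
of the integer matrix `R` of Bedi–Suagee / the cell's blueprint** (`BS26.rE`: row `(★,a)` = `[k = a]`,
row `(a,★)` = `[l = a]`, inner row `(a,b)` = `[k = b] + [l = a] − 4·[(k,l) = (b,a)]`, `★ = Fin.last n`).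
PROVED from the closed form `hessianMatrix_perPoly_caiChenLiMatrix_offDiag` (Cai–Chen–Li Lemma 2.5
and the through-`★` entries) at `v = −n`, where the inner transposed-pair value `v + (n−2)` is `−2`.
[cite: CaiChenLi2010, Lemma 2.5, p. 44] [cite: BediSuagee2026, companion repository (the matrix `R`)] -/
theorem hessianMatrix_perPoly_caiChenLiMatrix_neg_apply {n : ℕ} {i j k l : Fin (n + 1)}
    (hij : i ≠ j) (hkl : k ≠ l) :
    hessianMatrix (perPoly (Fin (n + 1)) F) (caiChenLiMatrix F n (-(n : F))) (i, j) (k, l) =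
      BS26.rE F (i, j) (k, l) := by
  rw [hessianMatrix_perPoly_caiChenLiMatrix_offDiag (-(n : F)) hkl hij]
  simp only [BS26.rE]
  by_cases hi : i = Fin.last n
  · -- row `(★, j)`: the indicator `[k = j]`
    subst hi
    have hj : j ≠ Fin.last n := Ne.symm hij
    rw [if_pos rfl]
    by_cases hkj : k = j
    · subst hkj
      by_cases hl : l = Fin.last n
      · subst hl
        simp
      · simp [hl, Ne.symm hl, hj]
    · simp [hkj, Ne.symm hkj]
      exact fun h => h.symm
  · by_cases hj : j = Fin.last n
    · -- row `(i, ★)`: the indicator `[l = i]`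
      subst hj
      rw [if_neg hi, if_pos rfl]
      by_cases hli : l = i
      · subst hli
        by_cases hk : k = Fin.last n
        · subst hk
          simp
        · simp [hk, Ne.symm hk, hi]
      · simp [hli, Ne.symm hli]
        exact fun h => h.symm
    · -- inner row `(i, j)`
      rw [if_neg hi, if_neg hj]
      by_cases hkj : k = j
      · subst hkj
        by_cases hli : l = i
        · subst hli
          have h2n : 2 ≤ n := two_le_of_ne_of_ne_last_bs26D (Ne.symm hij) hj hi
          simp only [and_self, if_true, hi, hj, or_self, if_false]
          rw [Nat.cast_sub h2n]
          push_cast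
          ring
        · simp [hli, Ne.symm hli, hj]
      · by_cases hli : l = i
        · subst hli
          simp [hkj, Ne.symm hkj, hi]
        · simp [hkj, hli, Ne.symm hkj, Ne.symm hli]

/-- **The principal submatrix of `H(per_{n+1})(Mⁿ_{−n})` on the off-diagonal pairs
`P = {(i,j) : i ≠ j}` IS the matrix `R = BS26.bsR`** (entrywise form of the bridge).
[cite: BediSuagee2026, companion repository (the matrix `R`)] [cite: CaiChenLi2010, Lemma 2.5, p. 44] -/
theorem submatrix_hessianMatrix_perPoly_caiChenLiMatrix_neg (n : ℕ) :
    (hessianMatrix (perPoly (Fin (n + 1)) F) (caiChenLiMatrix F n (-(n : F)))).submatrix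
        (fun p : BS26.OffDiag n => p.1) (fun p : BS26.OffDiag n => p.1) = BS26.bsR F := by
  ext p t
  obtain ⟨⟨i, j⟩, hij⟩ := p
  obtain ⟨⟨k, l⟩, hkl⟩ := t
  simp only [Matrix.submatrix_apply, BS26.bsR]
  exact hessianMatrix_perPoly_caiChenLiMatrix_neg_apply hij hkl

/-- **Rank of the off-diagonal block: exactly `(n+1)·n = |P|`** over a field with `2 ≠ 0` (from the
explicit inverse `R·S = 4·1`, `BS26.rank_bsR`). [cite: BediSuagee2026, companion repository] -/
theorem rank_submatrix_hessianMatrix_perPoly_caiChenLiMatrix_neg (h2 : (2 : F) ≠ 0) (n : ℕ) :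
    ((hessianMatrix (perPoly (Fin (n + 1)) F) (caiChenLiMatrix F n (-(n : F)))).submatrix
        (fun p : BS26.OffDiag n => p.1) (fun p : BS26.OffDiag n => p.1)).rank = (n + 1) * n := by
  rw [submatrix_hessianMatrix_perPoly_caiChenLiMatrix_neg, BS26.rank_bsR F h2]

/-- **Hessian rank at the witness: `(n+1)·n ≤ rank H(per_{n+1})(Mⁿ_{−n})`** over every field with
`2 ≠ 0` (the rank of a matrix bounds the rank of any submatrix, Mathlib `Matrix.rank_submatrix_le`).
This sharpens `rank_hessianMatrix_perPoly_caiChenLiMatrix_neg` (`n² − n ≤ rank + 2(n+1)`, the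
inverse-free interim form) to the full off-diagonal rank. (The full `(n+1)² × (n+1)²` Hessian has
rank `(n+1)·n + 2` over `ℚ`; not needed and not proved here.)
[cite: BediSuagee2026, companion repository] [cite: MignonRessayre2004, §2–3 (the Hessian method)] -/
theorem rank_hessianMatrix_perPoly_caiChenLiMatrix_neg_ge (h2 : (2 : F) ≠ 0) (n : ℕ) :
    (n + 1) * n ≤
      (hessianMatrix (perPoly (Fin (n + 1)) F) (caiChenLiMatrix F n (-(n : F)))).rank := by
  classical
  have h := Matrix.rank_submatrix_le
    (hessianMatrix (perPoly (Fin (n + 1)) F) (caiChenLiMatrix F n (-(n : F))))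
    (fun p : BS26.OffDiag n => p.1) (fun p : BS26.OffDiag n => p.1)
  rwa [rank_submatrix_hessianMatrix_perPoly_caiChenLiMatrix_neg h2] at h

/-- The witness is a zero of the permanent over EVERY field: `per(Mⁿ_{−n}) = n + (−n) = 0`
(Cai–Chen–Li's `per(Mⁿ_v) = n + v` with the corner `v = −n` taken in the field).
[cite: CaiChenLi2010, Lemma 3.1 (proof, «per(M) = n+1»), p. 45] -/
theorem eval_caiChenLiMatrix_neg_perPoly (n : ℕ) :
    eval (caiChenLiMatrix F n (-(n : F))) (perPoly (Fin (n + 1)) F) = 0 := by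
  rw [eval_caiChenLiMatrix_perPoly, add_neg_cancel]

/-- **`m² − m ≤ 2·dc(per_m)` over every field in which `2 ≠ 0`, for every `m`** — the target of row
BS26-A: an exclusion-free, divisibility-free quadratic lower bound for the determinantal complexity
of the permanent in every characteristic `≠ 2` (for `m = n+1`: `per(Mⁿ_{−n}) = 0`,
`rank H(Mⁿ_{−n}) ≥ (n+1)n = m² − m` by the full-rank certificate, and the Mignon–Ressayre chain rule
`rank H(X₀) ≤ 2·dc` at a zero `X₀`, `rank_hessianMatrix_le_two_mul_determinantalComplexity`; `m = 0`
is trivial). In characteristic `0` the tree has the stronger `m² ≤ 2·dc(per_m)`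
(`sq_le_two_mul_determinantalComplexity_perPoly_charZero_holds`). Attribution: the integer witness
(= `Mⁿ_{−n}` up to moving the special index) and the full-rank statement are Bedi–Suagee's
(printed text not held by the cell; statement inferred from the companion repository and
RE-PROVED here — no named fact is taken from it); Hessian method Mignon–Ressayre 2004, witness family
Cai–Chen–Li 2010. Honest framing: a quadratic bound; `VP ≠ VNP` is not proved and nothing here is
progress on it. [cite: BediSuagee2026, main theorem (as inferred from the companion repository)]
[cite: MignonRessayre2004, §3] [cite: CaiChenLi2010, §2.1–2.2, pp. 41–43] -/
theorem sq_sub_le_two_mul_determinantalComplexity_perPoly_of_two_ne_zero (F : Type u) [Field F]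
    (h2 : (2 : F) ≠ 0) (m : ℕ) : m ^ 2 - m ≤ 2 * determinantalComplexity (perPoly (Fin m) F) := by
  cases m with
  | zero => simp
  | succ n =>
    have hr := rank_hessianMatrix_perPoly_caiChenLiMatrix_neg_ge (F := F) h2 n
    have hd := rank_hessianMatrix_le_two_mul_determinantalComplexity
      (perPoly (Fin (n + 1)) F) (caiChenLiMatrix F n (-(n : F))) (eval_caiChenLiMatrix_neg_perPoly n)
    have hsq : (n + 1) ^ 2 - (n + 1) = (n + 1) * n := by
      have : (n + 1) ^ 2 = (n + 1) * n + (n + 1) := by ring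
      omega
    rw [hsq]
    exact hr.trans hd

/-- The same bound in binomial form: **`C(m,2) ≤ dc(per_m)`** over every field with `2 ≠ 0`.
[cite: BediSuagee2026, main theorem (as inferred from the companion repository)] -/
theorem choose_two_le_determinantalComplexity_perPoly_of_two_ne_zero (F : Type u) [Field F]
    (h2 : (2 : F) ≠ 0) (m : ℕ) : m.choose 2 ≤ determinantalComplexity (perPoly (Fin m) F) := by
  have h := sq_sub_le_two_mul_determinantalComplexity_perPoly_of_two_ne_zero F h2 m
  rw [Nat.choose_two_right]
  have hm : m * (m - 1) = m ^ 2 - m := by rw [sq, Nat.mul_sub_one]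
  rw [hm]
  omega

/-- **Odd characteristic, by name**: for an odd prime `p` and any field of characteristic `p`,
`m² − m ≤ 2·dc(per_m)` for every `m` — superseding numerically (not textually) the consequences of
Cai–Chen–Li's Thm. 2.3 (`(n−p−2)(n−p−3) ≤ 2·dc(per_n)`, `caiChenLi2010_quadratic_lower_bound`) and
the interim `m² ≤ 2·dc(per_m) + 5m`. [cite: BediSuagee2026, main theorem (as inferred from the
companion repository)] [cite: CaiChenLi2010, Thm. 2.3 / Cor. 2.4, p. 43] -/
theorem sq_sub_le_two_mul_determinantalComplexity_perPoly_charP (p : ℕ) [Fact p.Prime]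
    (F : Type u) [Field F] [CharP F p] (hp : p ≠ 2) (m : ℕ) :
    m ^ 2 - m ≤ 2 * determinantalComplexity (perPoly (Fin m) F) := by
  refine sq_sub_le_two_mul_determinantalComplexity_perPoly_of_two_ne_zero F ?_ m
  intro h
  have h' : p ∣ 2 := by
    rw [← CharP.cast_eq_zero_iff F p 2]
    exact_mod_cast h
  have hp2 : p ≤ 2 := Nat.le_of_dvd (by norm_num) h'
  have := (Fact.out : p.Prime).two_le
  omega

/-- **Every field of characteristic `≠ 2`** (`ringChar F ≠ 2`): `m² − m ≤ 2·dc(per_m)` for every `m`.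
[cite: BediSuagee2026, main theorem (as inferred from the companion repository)] -/
theorem sq_sub_le_two_mul_determinantalComplexity_perPoly_of_ringChar_ne_two (F : Type u) [Field F]
    (hF : ringChar F ≠ 2) (m : ℕ) : m ^ 2 - m ≤ 2 * determinantalComplexity (perPoly (Fin m) F) := by
  refine sq_sub_le_two_mul_determinantalComplexity_perPoly_of_two_ne_zero F ?_ m
  intro h
  have h' : ringChar F ∣ 2 := by
    rw [← ringChar.spec F 2]
    exact_mod_cast h
  rcases (Nat.dvd_prime Nat.prime_two).mp h' with h1 | h2
  · exact CharP.ringChar_ne_one h1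
  · exact hF h2

end FullRank

end Literature.Computability.AlgebraicComplexity
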